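import Summits.BirchSwinnertonDyer.BirchSwinnertonDyer.Theorems.KolyvaginDepthDoorMSymbolCertPeriods
import Literature.NumberTheory.EllipticCurves.PAdicLFunctionMinus
import Literature.NumberTheory.EllipticCurves.GrossZagierRationalPointPeriodProofs
import HarnessLib

/-!
# Route `KolyvaginDepthDoor`, crux `KolyvaginDepthSupplyKN` (stmt-BirchSwinnertonDyer-22820) —
# DEPTH TABLE v27, KIT 5: the ODD (imaginary-part) M-symbol eigenvector — relations, chains and the
# minus-period normalisation `[a/n]⁻_f = ε S⁻(a/n)/(2g)`

Helper file of the lead prover of line `levelone` (kdd-p1 g31; `--supports stmt-BirchSwinnertonDyer-22820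
--as helper`); it closes nothing and BSD is NOT proved by it.

Odd twin of kits 1 and 3 (`…MSymbolCertCosets`, `…MSymbolCertPeriods`): for `Ψ⁻ f i = im [e N i]_f` the
two-term, three-term and Popa–Zagier Hecke relations hold verbatim and conjugation acts by `−1`
(`relIm_iota`: `Ψ⁻(ι i) = −Ψ⁻(i)` for real Fourier coefficients); along a Manin-trick chain
`im {∞, a/n}_f = t · S⁻(a/n)` on the line through an integer vector `φ⁻`; and since `im Λ_f = ℤ · Ω⁻_f/2`
(`minusPeriod`), `t = ± Ω⁻_f/(2g)`, whence the tree's rational minus symbol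
`[a/n]⁻_f = ratMinusSymbol f (a/n) = ε · S⁻(a/n)/(2g)` (`exists_ratMinusSymbol_eq`). Needed for the twist
side of the depth-table rows: the plus symbols of an ODD quadratic twist `f ⊗ χ` are twisted sums of
minus symbols of `f` (`CuspFormTwistRatPlusSymbolOdd`).

References: [CremonaAlgorithms1997] §2.2–2.3, §2.8; [MazurTateTeitelbaum1986Invent] §I.8.
-/

set_option linter.dupNamespace false

noncomputable section

open scoped MatrixGroups ModularForm
open CongruenceSubgroup Matrix.SpecialLinearGroup ModularGroup Matrix
open Literature.NumberTheory.EllipticCurves Literature.NumberTheory.EllipticCurves.ModularForms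
open Literature.NumberTheory.Automorphic.PopaZagier (coeffN coeffN_det finite_support_coeffN
  orbT_zeta0_coeffN_eq)

namespace Summit.BirchSwinnertonDyer.BirchSwinnertonDyer.Theorems.KolyvaginDepthDoor.MSymbolCert

section Prime

variable {N : ℕ} [hN : Fact N.Prime]
variable (f : CuspForm (Gamma0 N) 2)

/-- `Ψ⁻ f i = im [e N i]_f`. [cite: CremonaAlgorithms1997, §2.2] -/
def Ψm (i : ℕ) : ℝ := ((msymbol N (e N i)) f).im

/-- Two-term relation for the imaginary parts. [cite: CremonaAlgorithms1997, §2.2 (2.2.5)] -/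
theorem relIm_two (i : ℕ) : Ψm f i + Ψm f (sIdx N i) = 0 := by
  have h := congrArg (fun φ : Module.Dual ℂ (CuspForm (Gamma0 N) 2) => (φ f).im)
    (msymbol_add_msymbol_S_inv_smul (N := N) (e N i))
  simp only [LinearMap.add_apply, Complex.add_im, LinearMap.zero_apply, Complex.zero_im] at h
  rw [inv_smul_e] at h
  exact h

/-- Three-term relation for the imaginary parts. [cite: CremonaAlgorithms1997, §2.2 (2.2.6)] -/
theorem relIm_three (i : ℕ) : Ψm f i + Ψm f (uIdx N i) + Ψm f (uIdx N (uIdx N i)) = 0 := by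
  have h := congrArg (fun φ : Module.Dual ℂ (CuspForm (Gamma0 N) 2) => (φ f).im)
    (msymbol_three_term (N := N) (e N i))
  simp only [LinearMap.add_apply, Complex.add_im, LinearMap.zero_apply, Complex.zero_im] at h
  rw [pow_two, mul_smul, inv_smul_e, Matrix.SpecialLinearGroup.coe_mul, inv_smul_e,
    Matrix.SpecialLinearGroup.coe_mul] at h
  exact h

/-- **Conjugation is ODD on imaginary parts**: `Ψ⁻(ι i) = −Ψ⁻(i)` for real Fourier coefficients.
[cite: CremonaAlgorithms1997, §2.1.4] -/
theorem relIm_iota (hreal : ∀ n, (cuspCoeff f n).im = 0) (i : ℕ) : Ψm f (iotaIdx N i) = -Ψm f i := by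
  unfold Ψm
  rw [e_iotaIdx, msymbol_mk_conjNeg f hreal, ← e_eq_mk, Complex.conj_im]

/-- **Hecke relation for the imaginary parts** (as `rel_hecke`). [cite: PopaZagier2017, Thm. 1, §5] -/
theorem relIm_hecke {n : ℕ} (hn : 0 < n) (hnN : n.Coprime N) {a : ℝ}
    (hT : heckeTnGamma0 N 2 n f = (a : ℂ) • f)
    (H : Finset (Matrix (Fin 2) (Fin 2) ℤ)) (hH : Function.support (coeffN n) ⊆ ↑H)
    (hdet : ∀ M ∈ H, M.det = n) (i : ℕ) :
    ∑ M ∈ H, (coeffN n M : ℝ) * Ψm f (actIdx N M i) = 2 * a * Ψm f i := by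
  have hn' : (0 : ℤ) < n := by exact_mod_cast hn
  have key := finsum_smul_msymbol_eq f hn hnN (finite_support_coeffN n) (fun M hM => coeffN_det hM)
    (fun M hM => orbT_zeta0_coeffN_eq hn' hM) (e N i)
  rw [finsum_eq_sum_of_support_subset _ (s := H) ?_] at key
  swap
  · intro M hM
    exact hH (Function.support_smul_subset_left _ _ hM)
  rw [hT, map_smul] at key
  have key' := congrArg Complex.im key
  rw [Complex.im_sum] at key'
  have hunit : IsUnit (((n : ℤ) : ℤ) : ZMod N) := by
    rw [Int.cast_natCast]; exact (ZMod.isUnit_iff_coprime n N).mpr hnN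
  have hterm : ∀ M ∈ H, (coeffN n M • (msymbol N (actP N (e N i) M.adjugate)) f).im =
      (coeffN n M : ℝ) * Ψm f (actIdx N M i) := by
    intro M hM
    have hM : IsUnit ((M.det : ℤ) : ZMod N) := by rw [hdet M hM]; exact hunit
    rw [actP_e_adjugate N hM, Complex.smul_im, Rat.smul_def, Ψm]
  rw [Finset.sum_congr rfl hterm] at key'
  rw [key', Complex.smul_im, smul_eq_mul, Complex.im_ofReal_mul, Ψm, Rat.smul_def]
  push_cast
  ring

/-! ### Chains -/

/-- Imaginary parts along a chain on the line through `φ`: `im ∑ [e i]_f = t · ∑ φ`. [folklore] -/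
theorem im_chain_sum_eq (φ : ℕ → ℤ) (t : ℝ) (hΨ : ∀ i, Ψm f i = t * φ i) (L : List ℕ) :
    ((L.map fun i => (msymbol N (e N i)) f).sum).im = t * ((L.map φ).sum : ℤ) := by
  induction L with
  | nil => simp
  | cons i L ih =>
    simp only [List.map_cons, List.sum_cons, Complex.add_im, ih, Int.cast_add]
    rw [show ((msymbol N (e N i)) f).im = Ψm f i from rfl, hΨ i]
    ring

/-! ### Minus-period normalisation -/

/-- **Normalisation (odd).** If `im [q]_f = t · φ(q)` on all cosets with `φ` integral (`f` a normalised
rational newform), then `t = ± Ω⁻_f/(2g)` for an integer `g ≥ 1` (`im Λ_f = ℤ · Ω⁻_f/2`, every period an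
integral chain of M-symbols). [cite: CremonaAlgorithms1997, §2.8] -/
theorem exists_minusPeriod_div (hf : IsNewform0 f) (hQ : coeffField f = ⊥) {t : ℝ}
    {φ : Gamma0Coset N → ℤ} (hΨ : ∀ q, ((msymbol N q) f).im = t * φ q) :
    ∃ g : ℕ, 0 < g ∧ (t = minusPeriod f / (2 * g) ∨ t = -(minusPeriod f / (2 * g))) := by
  have hΩ : 0 < minusPeriod f := IsNewform0.minusPeriod_pos_holds hf hQ
  have him : imagPeriods f = AddSubgroup.zmultiples (minusPeriod f / 2) :=
    imagPeriods_eq_zmultiples_of_minusPeriod_pos f hΩ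
  have hlat : ∀ x ∈ periodLattice f, ∃ m : ℤ, x.im = t * m := by
    intro x hx
    induction hx using AddSubgroup.closure_induction with
    | mem x hx =>
      obtain ⟨γ, rfl⟩ := hx
      obtain ⟨c, hcint, hcm, -⟩ := exists_chain (N := N) (γ : SL(2, ℤ))
      have hval : cuspSymbol f γ = (msymbolMap N c) f := by
        rw [cuspSymbol_eq_inftySymbol, ← inftyFunctional_apply, ← hcm]
      rw [hval, msymbolMap, Fintype.linearCombination_apply, LinearMap.sum_apply, Complex.im_sum]
      choose mq hmq using hcint
      refine ⟨∑ q, mq q * φ q, ?_⟩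
      push_cast
      rw [Finset.mul_sum]
      refine Finset.sum_congr rfl fun q _ => ?_
      rw [LinearMap.smul_apply, Complex.smul_im, hΨ q, hmq q, Rat.smul_def]
      push_cast
      ring
    | zero => exact ⟨0, by simp⟩
    | add x y _ _ hx hy =>
      obtain ⟨a, ha⟩ := hx; obtain ⟨b, hb⟩ := hy
      exact ⟨a + b, by rw [Complex.add_im, ha, hb]; push_cast; ring⟩
    | neg x _ hx =>
      obtain ⟨a, ha⟩ := hx
      exact ⟨-a, by rw [Complex.neg_im, ha]; push_cast; ring⟩
  have hmem : minusPeriod f / 2 ∈ imagPeriods f := by rw [him]; exact AddSubgroup.mem_zmultiples _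
  rw [imagPeriods, AddSubgroup.mem_map] at hmem
  obtain ⟨x, hx, hxim⟩ := hmem
  obtain ⟨m, hm⟩ := hlat x hx
  have hxim' : x.im = minusPeriod f / 2 := hxim
  rw [hxim'] at hm
  have hm0 : m ≠ 0 := by
    rintro rfl
    simp at hm
    linarith
  refine ⟨m.natAbs, Int.natAbs_pos.mpr hm0, ?_⟩
  rcases le_or_gt 0 m with hpos | hneg
  · left
    have : (m.natAbs : ℝ) = m := by rw [← Int.cast_natCast, Int.natAbs_of_nonneg hpos]
    rw [this]
    have hmR : (m : ℝ) ≠ 0 := by exact_mod_cast hm0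
    field_simp
    linarith
  · right
    have : (m.natAbs : ℝ) = -m := by
      rw [← Int.cast_natCast, Int.ofNat_natAbs_of_nonpos hneg.le, Int.cast_neg]
    rw [this]
    have hmR : (m : ℝ) ≠ 0 := by exact_mod_cast hm0
    field_simp
    linarith

/-- **The value of `[a/n]⁻_f` on the line through `φ⁻`.** If `im [e N i]_f = t φ(i)` for all `i ≤ N`
(`f` a normalised rational newform), there are `g ≥ 1` and `ε = ±1`, the same for all `(a, n, w)`, with
`ratMinusSymbol f (a/n) = ε · S⁻/(2g)`, `S⁻ = chainSum N φ fuel n w` (`a w ≡ 1 (mod n)`, `0 < n < fuel`).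
[cite: MazurTateTeitelbaum1986Invent, §I.8] -/
theorem exists_ratMinusSymbol_eq (hf : IsNewform0 f) (hQ : coeffField f = ⊥) {t : ℝ} {φ : ℕ → ℤ}
    (hΨ : ∀ i ≤ N, Ψm f i = t * φ i) :
    ∃ (g : ℕ) (ε : ℤ), 0 < g ∧ (ε = 1 ∨ ε = -1) ∧
      ∀ (a w : ℤ) (n : ℕ), 0 < n → a * w % n = 1 → ∀ fuel : ℕ, n < fuel →
        ratMinusSymbol f ((a : ℚ) / n) = ε * chainSum N φ fuel n w / (2 * g) := by
  have hΨ' : ∀ i, Ψm f i = t * φ (min i N) := by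
    intro i
    by_cases hi : i ≤ N
    · rw [min_eq_left hi]; exact hΨ i hi
    · have hi' : N < i := not_le.mp hi
      have : e N i = e N N := by unfold e; simp [hi'.le]
      rw [min_eq_right hi'.le, show Ψm f i = Ψm f N by simp [Ψm, this]]
      exact hΨ N le_rfl
  have hall : ∀ q : Gamma0Coset N, ((msymbol N q) f).im = t * φ (min (cosetIdx q) N) := by
    intro q
    rw [← hΨ' (cosetIdx q), Ψm, e_cosetIdx]
  obtain ⟨g, hg, ht⟩ := exists_minusPeriod_div f hf hQ hall
  have hΩ : 0 < minusPeriod f := IsNewform0.minusPeriod_pos_holds hf hQ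
  have hreal : ∀ m, (cuspCoeff f m).im = 0 := cuspCoeff_im_eq_zero_of_coeffField_eq_bot hQ
  set ε : ℤ := if t = minusPeriod f / (2 * g) then 1 else -1 with hε
  have hε1 : ε = 1 ∨ ε = -1 := by rw [hε]; split_ifs <;> simp
  have htε : t = (ε : ℝ) * (minusPeriod f / (2 * g)) := by
    rw [hε]; split_ifs with h
    · simp [h]
    · rcases ht with h' | h'
      · exact absurd h' h
      · rw [h']; simp
  refine ⟨g, ε, hg, hε1, ?_⟩
  intro a w n hn hw fuel hfuel
  -- `[a/n]⁻ = im {∞, a/n} / Ω⁻`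
  have hsym : (ratMinusSymbol f ((a : ℚ) / n) : ℝ) = (modularSymbol f ((a : ℚ) / n)).im / minusPeriod f := by
    rw [ratCast_ratMinusSymbol f hf hQ, normalizedMinusSymbol, minusSymbol_eq_im_mul_I_holds f hreal]
    simp
  have hchain := modularSymbol_eq_chain_sum f a w n hn hw fuel hfuel
  have hφ' : ∀ i, Ψm f i = t * (fun i => φ (min i N)) i := hΨ'
  have hre := im_chain_sum_eq f (fun i => φ (min i N)) t hφ' (chainIdx N fuel n w)
  have hminL : ((chainIdx N fuel (n : ℤ) w).map fun i => φ (min i N)) = (chainIdx N fuel (n : ℤ) w).map φ := by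
    apply List.map_congr_left
    intro i hi
    have : i ≤ N := by
      suffices h : ∀ fu z w', ∀ j ∈ chainIdx N fu z w', j ≤ N from h _ _ _ i hi
      intro fu
      induction fu with
      | zero => intro z w' j hj; simp [chainIdx] at hj
      | succ fu ih =>
        intro z w' j hj
        simp only [chainIdx] at hj
        split_ifs at hj with hz0
        · simp at hj
        · rcases List.mem_cons.mp hj with rfl | hj
          · rw [idxN_eq_idxZ]; exact idxZ_le N _ _
          · exact ih _ _ j hj
    rw [min_eq_left this]
  rw [hminL] at hre
  have hΩ0 : minusPeriod f ≠ 0 := hΩ.ne'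
  have hg0 : (g : ℝ) ≠ 0 := by exact_mod_cast hg.ne'
  have key : (ratMinusSymbol f ((a : ℚ) / n) : ℝ) = (ε : ℝ) * (chainSum N φ fuel n w : ℝ) / (2 * g) := by
    rw [hsym, hchain, hre, htε, chainSum]
    field_simp
  have : ((ratMinusSymbol f ((a : ℚ) / n) : ℚ) : ℝ) = ((ε * chainSum N φ fuel n w / (2 * g) : ℚ) : ℝ) := by
    rw [key]; push_cast; ring
  exact_mod_cast this

end Prime

end Summit.BirchSwinnertonDyer.BirchSwinnertonDyer.Theorems.KolyvaginDepthDoor.MSymbolCert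

end
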